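import Summits.BirchSwinnertonDyer.BirchSwinnertonDyer.Theorems.ResidualThetaTransportAtTwoSignedMuSeedAtTwoPlusCMManinPeriodRigidity
import Summits.BirchSwinnertonDyer.BirchSwinnertonDyer.Theorems.ResidualThetaTransportAtTwoSignedMuSeedAtTwoPlusCMManinPeriodHenselian
import HarnessLib

/-!
# CM Manin period IV — separating idempotents in subalgebras of `O^ι`, UNCONDITIONAL (algebraic kernel of stub P4 `inertRigidity` of the
# line card `cm-manin-period` assembled; seed crux `SignedMuSeedAtTwoPlus` stmt-BirchSwinnertonDyer-21438, parent Kμ⁺ stmt-BirchSwinnertonDyer-20689,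
# route ResidualThetaTransportAtTwo)

Cell `bsd-wall`, width seat `bsd-wall-rtt-p4-w2` g16 (`--supports`, closes nothing).  THEOREMS ONLY; BSD is not proved by this.

Assembly of `…CMManinPeriodRigidity.lean` (idempotents lift in Henselian pairs; coordinates `0/1`) and `…CMManinPeriodHenselian.lean`
(`(S, S ∩ 𝔪^ι)` IS Henselian for every `O`-subalgebra `S ⊆ (ι → O)`, `O` complete Noetherian local, `ι` finite):

* `mul_self_sub_mem_coordIdeal` — if every coordinate of `t ∈ S` is `≡ 0` or `≡ 1 (mod 𝔪_O)` then `t² − t ∈ S ∩ 𝔪^ι`;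
* **`indicator_mem_subalgebra`** — THEN the indicator function of `{i | t i ≡ 1 (mod 𝔪_O)}` belongs to `S`.

Card reading (step (c)): `O = O_L` (a finite extension of `ℤ₂` containing all values, complete DVR), `ι` = the CM types `τ` of `B`,
`S = O_L[ρ_B(G_K)] ⊆ ∏_τ O_L` (commutative: CM), `t = ρ_B(Frob_𝔞)` for a principal prime `𝔞 = (α)`, `α ≡ 1 (mod 𝔣₀)`, whose residues
`τ(φ(𝔞)) mod 𝔓` are `α̃` on one `K`-embedding class and `α̃²` on the other; with `α̃ = ζ₃ ∈ 𝔽₄` (CRT) the element `t' = (t − ζ₃²)(ζ₃ − ζ₃²)⁻¹ ∈ S`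
has residues `1`/`0` on the two classes, so `indicator_mem_subalgebra` puts the projector `e_K` onto one class in `S ⊆ End(T₂B) ⊗ O_L`, i.e.
`𝒪_K ⊗ ℤ₂ ⊆ End(B) ⊗ ℤ₂` after descent — the residual separation and the Galois/CM carriers remain the card's. [folklore]
-/

set_option autoImplicit false
-- the Theorems namespace of this sub repeats the summit name by design (D-0017 nested layout)
set_option linter.dupNamespace false

universe u

namespace Summit.BirchSwinnertonDyer.BirchSwinnertonDyer.Theorems.SignedMuAtTwo.CMManinPeriod

open IsLocalRing

variable {O : Type u} [CommRing O] [IsNoetherianRing O] [IsLocalRing O] {ι : Type u} [Fintype ι]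
  (S : Subalgebra O (ι → O))

omit [IsNoetherianRing O] [Fintype ι] in
/-- Coordinatewise `0/1` residues give `t² − t ∈ S ∩ 𝔪^ι`. [folklore] -/
theorem mul_self_sub_mem_coordIdeal (t : S)
    (ht : ∀ i, (t : ι → O) i ∈ maximalIdeal O ∨ (t : ι → O) i - 1 ∈ maximalIdeal O) :
    t * t - t ∈ Ideal.comap S.val (Ideal.pi fun _ : ι => maximalIdeal O) := by
  rw [mem_coordIdeal_iff]
  intro i
  have h : ((t * t - t : S) : ι → O) i = (t : ι → O) i * ((t : ι → O) i - 1) := by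
    simp only [Subalgebra.coe_sub, Subalgebra.coe_mul, Pi.sub_apply, Pi.mul_apply]
    ring
  rw [h]
  rcases ht i with h0 | h1
  · exact Ideal.mul_mem_right _ _ h0
  · exact Ideal.mul_mem_left _ _ h1

variable [IsAdicComplete (maximalIdeal O) O]

/-- **Separating idempotents lie in the algebra (unconditional form).**  Let `O` be a complete Noetherian local ring, `ι` finite,
`S ⊆ (ι → O)` any `O`-subalgebra and `t ∈ S` with every coordinate `≡ 0` or `≡ 1 (mod 𝔪_O)`.  Then the indicator function of
`{i | t i ≡ 1 (mod 𝔪_O)}` is an element of `S`. [folklore] -/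
theorem indicator_mem_subalgebra (t : S)
    (ht : ∀ i, (t : ι → O) i ∈ maximalIdeal O ∨ (t : ι → O) i - 1 ∈ maximalIdeal O)
    [DecidablePred fun i : ι => (t : ι → O) i - 1 ∈ maximalIdeal O] :
    (fun i => if (t : ι → O) i - 1 ∈ maximalIdeal O then (1 : O) else 0) ∈ S := by
  haveI := henselianRing_coordIdeal S
  obtain ⟨e, he, heJ⟩ := exists_isIdempotentElem_sub_mem
    (Ideal.comap S.val (Ideal.pi fun _ : ι => maximalIdeal O)) t (mul_self_sub_mem_coordIdeal S t ht)
  have hne : (1 : O) ∉ maximalIdeal O := fun h => (mem_maximalIdeal 1).mp h isUnit_one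
  have hidem : IsIdempotentElem (e : ι → O) := by
    have h2 := congrArg (fun x : S => (x : ι → O)) he.eq
    simpa [IsIdempotentElem, Subalgebra.coe_mul] using h2
  have hfun : (fun i => if (t : ι → O) i - 1 ∈ maximalIdeal O then (1 : O) else 0) = (e : ι → O) := by
    funext i
    have hdiff : (e : ι → O) i - (t : ι → O) i ∈ maximalIdeal O := by
      have h := coordIdeal_apply_mem S _ heJ i
      simpa [Subalgebra.coe_sub] using h
    rcases eq_zero_or_eq_one_of_isIdempotentElem (isIdempotentElem_apply hidem i) with h0 | h1
    · -- `e i = 0`: `t i ∈ 𝔪`, so `t i - 1 ∉ 𝔪`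
      rw [h0, zero_sub] at hdiff
      have ht𝔪 : (t : ι → O) i ∈ maximalIdeal O := by simpa using (maximalIdeal O).neg_mem hdiff
      rw [h0, if_neg]
      intro h
      exact hne (by simpa using (maximalIdeal O).sub_mem ht𝔪 h)
    · -- `e i = 1`: `t i - 1 ∈ 𝔪`
      rw [h1] at hdiff
      have ht1 : (t : ι → O) i - 1 ∈ maximalIdeal O := by simpa using (maximalIdeal O).neg_mem hdiff
      rw [h1, if_pos ht1]
  rw [hfun]
  exact e.prop

end Summit.BirchSwinnertonDyer.BirchSwinnertonDyer.Theorems.SignedMuAtTwo.CMManinPeriod
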